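import Summits.BirchSwinnertonDyer.BirchSwinnertonDyer.Theorems.Rank2ObservatoryQuadField17Places
import HarnessLib

/-!
# BirchSwinnertonDyer — rank ≥ 2 observatory: KERNEL-2DESC-Z2 row kit over `K = ℚ(√17)` (shared by the `μ_θ` rows over `ℚ(√17)`, first `428298m1`)

HONEST FRAMING: per-curve certified theorems and census instruments; no claim on BSD in rank ≥ 2.

Curve-independent infrastructure of the `μ_θ` descent rows over `K = ℚ(ω)`, `ω² = ω + 4` (class number one,
fundamental unit `ε = -3 - 2ω` of norm `-1`; `…QuadField17`, places `…QuadField17Places`), factored out of the row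
files so that no statement is proved twice in the tree:
* `lin_ne_lin` (`1, ω` are `ℤ`-independent);
* the unit class tables `bu… : Fin 2 → (ℤ/2)²` resp. `(ℤ/2)³` of the unit family `units = (-1, ε)` at the six named places
  `P13a, P13b` (over `13`), `P19a, P19b` (over `19`), `P24, P25` (over `2`), each entry a `bitsAt_eq` / `bitsAt₂_eq`
  certificate (`hbu…`);
* the real place `ρ : K → ℝ` with `ρ(ω) = (1 - √17)/2`, located by the rational bounds `-2 < ρ(ω) < -3/2`
  (`exists_rho_bounds`), and the evaluation rule `rho_lin`.
Sorry-free; standard axioms only; every residue computation is a `decide`.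
[cite: Cassels1991LecturesEllipticCurves, §15] [cite: CremonaAlgorithms1997, §3.6]
-/

-- single-conjunct summit: `Summit.BirchSwinnertonDyer.BirchSwinnertonDyer.…` repeats the name by design
set_option linter.dupNamespace false

noncomputable section

open scoped NumberField

open Polynomial Module NumberField

namespace Summit.BirchSwinnertonDyer.BirchSwinnertonDyer.Rank2Observatory.TwoDescZ2

namespace QuadField17

/-! ## Coefficient independence -/

/-- Distinct coefficient pairs give distinct `lin` elements (`1, ω` independent). [folklore] -/
theorem lin_ne_lin {p q p' q' : ℤ} (hne : p ≠ p' ∨ q ≠ q') :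
    (MonicQuad.lin aeval_ω p q : 𝓞 (QuadField (-1) (-4))) ≠ MonicQuad.lin aeval_ω p' q' := by
  intro h
  apply MonicQuad.lin_ne_zero irreducible aeval_ω finrank_eq (p := p - p') (q := q - q') (by omega)
  simp only [MonicQuad.lin, Int.cast_sub] at h ⊢
  linear_combination h

/-! ## Unit class tables at the named places (certificates `u = π^k β`, `res β` a unit) -/

/-- Classes `(k mod 2, χ(β))` of the units `(-1, ε)` at `P13a`. -/
def bu13a : Fin 2 → ZMod 2 × ZMod 2 := ![((0 : ZMod 2), (0 : ZMod 2)), ((0 : ZMod 2), (1 : ZMod 2))]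
/-- Classes `(k mod 2, χ(β))` of the units `(-1, ε)` at `P13b`. -/
def bu13b : Fin 2 → ZMod 2 × ZMod 2 := ![((0 : ZMod 2), (0 : ZMod 2)), ((0 : ZMod 2), (1 : ZMod 2))]
/-- Classes `(k mod 2, χ(β))` of the units `(-1, ε)` at `P19a`. -/
def bu19a : Fin 2 → ZMod 2 × ZMod 2 := ![((0 : ZMod 2), (1 : ZMod 2)), ((0 : ZMod 2), (1 : ZMod 2))]
/-- Classes `(k mod 2, χ(β))` of the units `(-1, ε)` at `P19b`. -/
def bu19b : Fin 2 → ZMod 2 × ZMod 2 := ![((0 : ZMod 2), (1 : ZMod 2)), ((0 : ZMod 2), (0 : ZMod 2))]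
/-- Classes `(k mod 2, β mod 8 bits)` of the units `(-1, ε)` at `P24`. -/
def bu24 : Fin 2 → ZMod 2 × ZMod 2 × ZMod 2 := ![((0 : ZMod 2), (1 : ZMod 2), (1 : ZMod 2)), ((0 : ZMod 2), (0 : ZMod 2), (1 : ZMod 2))]
/-- Classes `(k mod 2, β mod 8 bits)` of the units `(-1, ε)` at `P25`. -/
def bu25 : Fin 2 → ZMod 2 × ZMod 2 × ZMod 2 := ![((0 : ZMod 2), (1 : ZMod 2), (1 : ZMod 2)), ((0 : ZMod 2), (1 : ZMod 2), (0 : ZMod 2))]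

/-- The unit class table at `P13a` is correct (one `bitsAt_eq` certificate per unit). [folklore] -/
theorem hbu13a : ∀ i, bitsAt P13a ((units i : (𝓞 (QuadField (-1) (-4)))ˣ) : 𝓞 (QuadField (-1) (-4))) = bu13a i := by
  intro i
  fin_cases i
  · show bitsAt P13a (MonicQuad.lin aeval_ω (-1) 0) = ((0 : ZMod 2), (0 : ZMod 2))
    rw [bitsAt_eq (d := P13a) (k := 0) (β := MonicQuad.lin aeval_ω (-1) 0) (by rw [pow_zero, one_mul]) (by rw [P13a_res_lin]; decide),
      P13a_res_lin, qrOf_eq_sqb]; decide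
  · show bitsAt P13a (MonicQuad.lin aeval_ω (-3) (-2)) = ((0 : ZMod 2), (1 : ZMod 2))
    rw [bitsAt_eq (d := P13a) (k := 0) (β := MonicQuad.lin aeval_ω (-3) (-2)) (by rw [pow_zero, one_mul]) (by rw [P13a_res_lin]; decide),
      P13a_res_lin, qrOf_eq_sqb]; decide

/-- The unit class table at `P13b` is correct (one `bitsAt_eq` certificate per unit). [folklore] -/
theorem hbu13b : ∀ i, bitsAt P13b ((units i : (𝓞 (QuadField (-1) (-4)))ˣ) : 𝓞 (QuadField (-1) (-4))) = bu13b i := by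
  intro i
  fin_cases i
  · show bitsAt P13b (MonicQuad.lin aeval_ω (-1) 0) = ((0 : ZMod 2), (0 : ZMod 2))
    rw [bitsAt_eq (d := P13b) (k := 0) (β := MonicQuad.lin aeval_ω (-1) 0) (by rw [pow_zero, one_mul]) (by rw [P13b_res_lin]; decide),
      P13b_res_lin, qrOf_eq_sqb]; decide
  · show bitsAt P13b (MonicQuad.lin aeval_ω (-3) (-2)) = ((0 : ZMod 2), (1 : ZMod 2))
    rw [bitsAt_eq (d := P13b) (k := 0) (β := MonicQuad.lin aeval_ω (-3) (-2)) (by rw [pow_zero, one_mul]) (by rw [P13b_res_lin]; decide),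
      P13b_res_lin, qrOf_eq_sqb]; decide

/-- The unit class table at `P19a` is correct (one `bitsAt_eq` certificate per unit). [folklore] -/
theorem hbu19a : ∀ i, bitsAt P19a ((units i : (𝓞 (QuadField (-1) (-4)))ˣ) : 𝓞 (QuadField (-1) (-4))) = bu19a i := by
  intro i
  fin_cases i
  · show bitsAt P19a (MonicQuad.lin aeval_ω (-1) 0) = ((0 : ZMod 2), (1 : ZMod 2))
    rw [bitsAt_eq (d := P19a) (k := 0) (β := MonicQuad.lin aeval_ω (-1) 0) (by rw [pow_zero, one_mul]) (by rw [P19a_res_lin]; decide),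
      P19a_res_lin, qrOf_eq_sqb]; decide
  · show bitsAt P19a (MonicQuad.lin aeval_ω (-3) (-2)) = ((0 : ZMod 2), (1 : ZMod 2))
    rw [bitsAt_eq (d := P19a) (k := 0) (β := MonicQuad.lin aeval_ω (-3) (-2)) (by rw [pow_zero, one_mul]) (by rw [P19a_res_lin]; decide),
      P19a_res_lin, qrOf_eq_sqb]; decide

/-- The unit class table at `P19b` is correct (one `bitsAt_eq` certificate per unit). [folklore] -/
theorem hbu19b : ∀ i, bitsAt P19b ((units i : (𝓞 (QuadField (-1) (-4)))ˣ) : 𝓞 (QuadField (-1) (-4))) = bu19b i := by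
  intro i
  fin_cases i
  · show bitsAt P19b (MonicQuad.lin aeval_ω (-1) 0) = ((0 : ZMod 2), (1 : ZMod 2))
    rw [bitsAt_eq (d := P19b) (k := 0) (β := MonicQuad.lin aeval_ω (-1) 0) (by rw [pow_zero, one_mul]) (by rw [P19b_res_lin]; decide),
      P19b_res_lin, qrOf_eq_sqb]; decide
  · show bitsAt P19b (MonicQuad.lin aeval_ω (-3) (-2)) = ((0 : ZMod 2), (0 : ZMod 2))
    rw [bitsAt_eq (d := P19b) (k := 0) (β := MonicQuad.lin aeval_ω (-3) (-2)) (by rw [pow_zero, one_mul]) (by rw [P19b_res_lin]; decide),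
      P19b_res_lin, qrOf_eq_sqb]; decide

/-- The unit class table at `P24` is correct (one `bitsAt₂_eq` certificate per unit). [folklore] -/
theorem hbu24 : ∀ i, bitsAt₂ P24 ((units i : (𝓞 (QuadField (-1) (-4)))ˣ) : 𝓞 (QuadField (-1) (-4))) = bu24 i := by
  intro i
  fin_cases i
  · show bitsAt₂ P24 (MonicQuad.lin aeval_ω (-1) 0) = ((0 : ZMod 2), (1 : ZMod 2), (1 : ZMod 2))
    rw [bitsAt₂_eq (d := P24) (k := 0) (β := MonicQuad.lin aeval_ω (-1) 0) (by rw [pow_zero, one_mul]) (by rw [P24_res_lin]; decide),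
      P24_res_lin]; decide
  · show bitsAt₂ P24 (MonicQuad.lin aeval_ω (-3) (-2)) = ((0 : ZMod 2), (0 : ZMod 2), (1 : ZMod 2))
    rw [bitsAt₂_eq (d := P24) (k := 0) (β := MonicQuad.lin aeval_ω (-3) (-2)) (by rw [pow_zero, one_mul]) (by rw [P24_res_lin]; decide),
      P24_res_lin]; decide

/-- The unit class table at `P25` is correct (one `bitsAt₂_eq` certificate per unit). [folklore] -/
theorem hbu25 : ∀ i, bitsAt₂ P25 ((units i : (𝓞 (QuadField (-1) (-4)))ˣ) : 𝓞 (QuadField (-1) (-4))) = bu25 i := by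
  intro i
  fin_cases i
  · show bitsAt₂ P25 (MonicQuad.lin aeval_ω (-1) 0) = ((0 : ZMod 2), (1 : ZMod 2), (1 : ZMod 2))
    rw [bitsAt₂_eq (d := P25) (k := 0) (β := MonicQuad.lin aeval_ω (-1) 0) (by rw [pow_zero, one_mul]) (by rw [P25_res_lin]; decide),
      P25_res_lin]; decide
  · show bitsAt₂ P25 (MonicQuad.lin aeval_ω (-3) (-2)) = ((0 : ZMod 2), (1 : ZMod 2), (0 : ZMod 2))
    rw [bitsAt₂_eq (d := P25) (k := 0) (β := MonicQuad.lin aeval_ω (-3) (-2)) (by rw [pow_zero, one_mul]) (by rw [P25_res_lin]; decide),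
      P25_res_lin]; decide

/-! ## The real place `ω ↦ (1 - √17)/2` -/

/-- The real embedding with `ρ(ω) = (1 - √17)/2`, located by `-2 < ρ(ω) < -3/2`. [folklore] -/
theorem exists_rho_bounds : ∃ ρ : QuadField (-1) (-4) →+* ℝ, -2 < ρ (QuadField.root (-1) (-4)) ∧ ρ (QuadField.root (-1) (-4)) < -3 / 2 := by
  have hs : Real.sqrt 17 ^ 2 = 17 := Real.sq_sqrt (by norm_num)
  have hpos : 0 < Real.sqrt 17 := Real.sqrt_pos.mpr (by norm_num)
  have hx : eval₂ (algebraMap ℚ ℝ) ((1 - Real.sqrt 17) / 2) (MonicQuad.polyQ (-1) (-4)) = 0 := by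
    simp only [MonicQuad.polyQ_eq, eval₂_add, eval₂_mul, eval₂_pow, eval₂_X, eval₂_C]
    simp only [map_intCast]
    push_cast
    linear_combination (1 / 4 : ℝ) * hs
  refine ⟨AdjoinRoot.lift (algebraMap ℚ ℝ) ((1 - Real.sqrt 17) / 2) hx, ?_, ?_⟩
  · show -2 < AdjoinRoot.lift (algebraMap ℚ ℝ) ((1 - Real.sqrt 17) / 2) hx (AdjoinRoot.root _)
    rw [AdjoinRoot.lift_root]
    nlinarith
  · show AdjoinRoot.lift (algebraMap ℚ ℝ) ((1 - Real.sqrt 17) / 2) hx (AdjoinRoot.root _) < -3 / 2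
    rw [AdjoinRoot.lift_root]
    nlinarith

/-- A real embedding evaluates `p + qω` to `p + q·ρ(ω)`. [folklore] -/
theorem rho_lin (ρ : QuadField (-1) (-4) →+* ℝ) (p q : ℤ) :
    ρ (algebraMap (𝓞 (QuadField (-1) (-4))) (QuadField (-1) (-4)) (MonicQuad.lin aeval_ω p q)) = (p : ℝ) + (q : ℝ) * ρ (QuadField.root (-1) (-4)) := by
  rw [MonicQuad.algebraMap_lin, map_add, map_mul, map_intCast, map_intCast]

end QuadField17

end Summit.BirchSwinnertonDyer.BirchSwinnertonDyer.Rank2Observatory.TwoDescZ2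

end
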